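import Summits.Parity.GeneralizedHardyLittlewood.Theorems.PrimeLevelFamEdgeMomentsBeyondDiagonalDiagBoseInner
import Mathlib.MeasureTheory.Integral.Prod
import HarnessLib

/-!
# Route `PrimeLevelFamEdge`, crux K_A `MomentsBeyondDiagonal` (stmt-Parity-20007), line «petersson_layers» v4, stub `stub_diag`:
# SYMMETRY OF THE BOSE COEFFICIENTS `c_{ab}(y) = c_{ba}(y)` (Fubini on the region `u₁u₂ > y`; census R2)

`c_{ab}(y) = ∫_{u₁>0}(log u₁)^a ∫_{u₂>y/u₁} e^{−φ}(1−e^{−φ})^{−2}(log u₂)^b du₂ du₁` (`φ = u₁+u₂`, `…DiagBoseOuter`) is the integral over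
the symmetric region `{u₁, u₂ > 0, u₁u₂ > y}` of a kernel symmetric under `u₁ ↔ u₂` up to the exchange `a ↔ b`; by Fubini
(`integral_prod` / `integral_prod_symm`, domination by `(1−e^{−√y})^{−2}e^{−u₁}|log u₁|^a · e^{−u₂}|log u₂|^b`):

* `bose_coeff_eq_integral_prod` — `c_{ab}(y)` as ONE integral over `(0,∞)²` of the guarded integrand;
* `bose_coeff_symm` — **`c_{ab}(y) = c_{ba}(y)`** (`y > 0`).
With `…DiagBoseB0` (`c_{a0}(y) = ∫_0^∞(log u)^a du/(e^{u+y/u}−1)`) this gives the one-dimensional form of `c_{0b}` as well.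
Helper `--supports stmt-Parity-20007`; closes nothing; K_A, K_B and the Parity summit are NOT proved; nothing about Landau–Siegel zeros.
-/

noncomputable section

open Real Set MeasureTheory Filter Function
open Literature.NumberTheory.LFunctions

namespace Summit.Parity.GeneralizedHardyLittlewood.Theorems.MomentsBeyondDiagonal.DiagLines

/-- The guarded two-variable Bose integrand: `B(u₁+u₂)(log u₁)^a(log u₂)^b` on `{u₁>0, u₂>0, u₁u₂>y}`, `0` elsewhere. -/
theorem measurable_boseGuard (y : ℝ) (a b : ℕ) :
    Measurable (fun p : ℝ × ℝ ↦
      if 0 < p.1 ∧ 0 < p.2 ∧ y < p.1 * p.2 then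
        Real.exp (-(p.1 + p.2)) / (1 - Real.exp (-(p.1 + p.2))) ^ 2 * Real.log p.1 ^ a * Real.log p.2 ^ b else 0) := by
  have h1 : Measurable fun p : ℝ × ℝ ↦
      Real.exp (-(p.1 + p.2)) / (1 - Real.exp (-(p.1 + p.2))) ^ 2 * Real.log p.1 ^ a * Real.log p.2 ^ b :=
    (((Real.measurable_exp.comp (measurable_fst.add measurable_snd).neg).div
      ((measurable_const.sub (Real.measurable_exp.comp (measurable_fst.add measurable_snd).neg)).pow_const 2)).mul
      ((Real.measurable_log.comp measurable_fst).pow_const a)).mul ((Real.measurable_log.comp measurable_snd).pow_const b)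
  refine Measurable.ite ?_ h1 measurable_const
  exact (measurableSet_lt measurable_const measurable_fst).inter
    ((measurableSet_lt measurable_const measurable_snd).inter
      (measurableSet_lt measurable_const (measurable_fst.mul measurable_snd)))

/-- Integrability of the guarded integrand on `(0,∞)²` (domination by a product of one-variable weights). [folklore] -/
theorem integrable_boseGuard {y : ℝ} (hy : 0 < y) (a b : ℕ) :
    Integrable (fun p : ℝ × ℝ ↦
      if 0 < p.1 ∧ 0 < p.2 ∧ y < p.1 * p.2 then
        Real.exp (-(p.1 + p.2)) / (1 - Real.exp (-(p.1 + p.2))) ^ 2 * Real.log p.1 ^ a * Real.log p.2 ^ b else 0)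
      ((volume.restrict (Ioi (0 : ℝ))).prod (volume.restrict (Ioi (0 : ℝ)))) := by
  set Cy : ℝ := ((1 - Real.exp (-Real.sqrt y)) ^ 2)⁻¹ with hCy
  have hCy0 : 0 ≤ Cy := by rw [hCy]; positivity
  have hA : Integrable (fun u : ℝ ↦ Cy * (Real.exp (-u) * |(0 : ℝ) + Real.log u| ^ a)) (volume.restrict (Ioi (0 : ℝ))) :=
    (integrableOn_exp_neg_mul_abs_logPow 0 a).const_mul Cy
  have hB : Integrable (fun u : ℝ ↦ Real.exp (-u) * |(0 : ℝ) + Real.log u| ^ b) (volume.restrict (Ioi (0 : ℝ))) :=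
    integrableOn_exp_neg_mul_abs_logPow 0 b
  have hmaj := hA.mul_prod hB
  refine Integrable.mono' hmaj (measurable_boseGuard y a b).aestronglyMeasurable (ae_of_all _ fun p ↦ ?_)
  simp only [zero_add]
  by_cases h : 0 < p.1 ∧ 0 < p.2 ∧ y < p.1 * p.2
  · rw [if_pos h]
    obtain ⟨h1, h2, h3⟩ := h
    have hu₂ : y / p.1 < p.2 := by rw [div_lt_iff₀ h1]; linarith [mul_comm p.1 p.2]
    have hK := bose_kernel_le hy h1 hu₂
    have hK0 : 0 ≤ Real.exp (-(p.1 + p.2)) / (1 - Real.exp (-(p.1 + p.2))) ^ 2 :=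
      div_nonneg (Real.exp_pos _).le (sq_nonneg _)
    rw [norm_mul, norm_mul, Real.norm_of_nonneg hK0, norm_pow, norm_pow, Real.norm_eq_abs, Real.norm_eq_abs]
    calc Real.exp (-(p.1 + p.2)) / (1 - Real.exp (-(p.1 + p.2))) ^ 2 * |Real.log p.1| ^ a * |Real.log p.2| ^ b
        ≤ Cy * (Real.exp (-p.1) * Real.exp (-p.2)) * |Real.log p.1| ^ a * |Real.log p.2| ^ b := by
          rw [hCy]; gcongr
      _ = Cy * (Real.exp (-p.1) * |Real.log p.1| ^ a) * (Real.exp (-p.2) * |Real.log p.2| ^ b) := by ring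
  · rw [if_neg h, norm_zero]
    exact mul_nonneg (mul_nonneg hCy0 (by positivity)) (by positivity)

/-- For `u₁ > 0`: the `u₂`-integral over `(0,∞)` of the guarded integrand is the inner Bose integral times `(log u₁)^a`. -/
theorem integral_boseGuard_snd {y u₁ : ℝ} (hy : 0 < y) (hu₁ : 0 < u₁) (a b : ℕ) :
    ∫ u₂ in Ioi (0 : ℝ), (if 0 < u₁ ∧ 0 < u₂ ∧ y < u₁ * u₂ then
        Real.exp (-(u₁ + u₂)) / (1 - Real.exp (-(u₁ + u₂))) ^ 2 * Real.log u₁ ^ a * Real.log u₂ ^ b else 0) =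
      Real.log u₁ ^ a *
        ∫ u₂ in Ioi (y / u₁), Real.exp (-(u₁ + u₂)) / (1 - Real.exp (-(u₁ + u₂))) ^ 2 * Real.log u₂ ^ b := by
  have hz : 0 < y / u₁ := div_pos hy hu₁
  rw [← integral_const_mul, ← integral_indicator measurableSet_Ioi, ← integral_indicator measurableSet_Ioi]
  refine integral_congr_ae (ae_of_all _ fun u₂ ↦ ?_)
  simp only [Set.indicator, mem_Ioi]
  by_cases h2 : 0 < u₂
  · rw [if_pos h2]
    by_cases h3 : y / u₁ < u₂
    · have : y < u₁ * u₂ := by rw [div_lt_iff₀ hu₁] at h3; linarith [mul_comm u₁ u₂]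
      rw [if_pos ⟨hu₁, h2, this⟩, if_pos h3]; ring
    · have : ¬ (y < u₁ * u₂) := by
        intro hlt; apply h3; rw [div_lt_iff₀ hu₁]; linarith [mul_comm u₁ u₂]
      rw [if_neg (fun h ↦ this h.2.2), if_neg h3]
  · have h3 : ¬ (y / u₁ < u₂) := fun hlt ↦ h2 (hz.trans hlt)
    rw [if_neg h2, if_neg h3]

/-- For `u₂ > 0`: the `u₁`-integral over `(0,∞)` of the guarded integrand (roles exchanged). -/
theorem integral_boseGuard_fst {y u₂ : ℝ} (hy : 0 < y) (hu₂ : 0 < u₂) (a b : ℕ) :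
    ∫ u₁ in Ioi (0 : ℝ), (if 0 < u₁ ∧ 0 < u₂ ∧ y < u₁ * u₂ then
        Real.exp (-(u₁ + u₂)) / (1 - Real.exp (-(u₁ + u₂))) ^ 2 * Real.log u₁ ^ a * Real.log u₂ ^ b else 0) =
      Real.log u₂ ^ b *
        ∫ u₁ in Ioi (y / u₂), Real.exp (-(u₂ + u₁)) / (1 - Real.exp (-(u₂ + u₁))) ^ 2 * Real.log u₁ ^ a := by
  have hz : 0 < y / u₂ := div_pos hy hu₂
  rw [← integral_const_mul, ← integral_indicator measurableSet_Ioi, ← integral_indicator measurableSet_Ioi]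
  refine integral_congr_ae (ae_of_all _ fun u₁ ↦ ?_)
  simp only [Set.indicator, mem_Ioi]
  by_cases h1 : 0 < u₁
  · rw [if_pos h1]
    by_cases h3 : y / u₂ < u₁
    · have : y < u₁ * u₂ := by rw [div_lt_iff₀ hu₂] at h3; linarith
      rw [if_pos ⟨h1, hu₂, this⟩, if_pos h3, add_comm u₂ u₁]; ring
    · have : ¬ (y < u₁ * u₂) := by
        intro hlt; apply h3; rw [div_lt_iff₀ hu₂]; linarith
      rw [if_neg (fun h ↦ this h.2.2), if_neg h3]
  · have h3 : ¬ (y / u₂ < u₁) := fun hlt ↦ h1 (hz.trans hlt)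
    rw [if_neg h1, if_neg h3]

/-- **Symmetry of the Bose coefficients**: for `y > 0` and all `a, b`,
`∫_{u₁>0}(log u₁)^a ∫_{u₂>y/u₁} B(u₁+u₂)(log u₂)^b = ∫_{u₁>0}(log u₁)^b ∫_{u₂>y/u₁} B(u₁+u₂)(log u₂)^a`
(`B(φ) = e^{−φ}(1−e^{−φ})^{−2}`; Fubini on `{u₁u₂ > y}`). [folklore] -/
theorem bose_coeff_symm {y : ℝ} (hy : 0 < y) (a b : ℕ) :
    ∫ u₁ in Ioi (0 : ℝ), Real.log u₁ ^ a *
        ∫ u₂ in Ioi (y / u₁), Real.exp (-(u₁ + u₂)) / (1 - Real.exp (-(u₁ + u₂))) ^ 2 * Real.log u₂ ^ b =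
      ∫ u₁ in Ioi (0 : ℝ), Real.log u₁ ^ b *
        ∫ u₂ in Ioi (y / u₁), Real.exp (-(u₁ + u₂)) / (1 - Real.exp (-(u₁ + u₂))) ^ 2 * Real.log u₂ ^ a := by
  have hF := integrable_boseGuard hy a b
  have h12 := integral_prod _ hF
  have h21 := integral_prod_symm _ hF
  -- both iterated integrals, rewritten
  have hL : ∫ u₁ in Ioi (0 : ℝ), ∫ u₂ in Ioi (0 : ℝ), (if 0 < u₁ ∧ 0 < u₂ ∧ y < u₁ * u₂ then
        Real.exp (-(u₁ + u₂)) / (1 - Real.exp (-(u₁ + u₂))) ^ 2 * Real.log u₁ ^ a * Real.log u₂ ^ b else 0) =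
      ∫ u₁ in Ioi (0 : ℝ), Real.log u₁ ^ a *
        ∫ u₂ in Ioi (y / u₁), Real.exp (-(u₁ + u₂)) / (1 - Real.exp (-(u₁ + u₂))) ^ 2 * Real.log u₂ ^ b :=
    setIntegral_congr_fun measurableSet_Ioi fun u₁ hu₁ ↦ integral_boseGuard_snd hy hu₁ a b
  have hR : ∫ u₂ in Ioi (0 : ℝ), ∫ u₁ in Ioi (0 : ℝ), (if 0 < u₁ ∧ 0 < u₂ ∧ y < u₁ * u₂ then
        Real.exp (-(u₁ + u₂)) / (1 - Real.exp (-(u₁ + u₂))) ^ 2 * Real.log u₁ ^ a * Real.log u₂ ^ b else 0) =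
      ∫ u₂ in Ioi (0 : ℝ), Real.log u₂ ^ b *
        ∫ u₁ in Ioi (y / u₂), Real.exp (-(u₂ + u₁)) / (1 - Real.exp (-(u₂ + u₁))) ^ 2 * Real.log u₁ ^ a :=
    setIntegral_congr_fun measurableSet_Ioi fun u₂ hu₂ ↦ integral_boseGuard_fst hy hu₂ a b
  rw [← hL, ← h12, h21, hR]

end Summit.Parity.GeneralizedHardyLittlewood.Theorems.MomentsBeyondDiagonal.DiagLines

end
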